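import Mathlib
import HarnessLib
import Summits.HubbardSuperconductivity.HubbardSuperconductivity.Theorems.KLProgrammeKLRegimeCountertermJacksonRemainderCurve
import Summits.HubbardSuperconductivity.HubbardSuperconductivity.Theorems.KLProgrammePerturbedFermiCurveCompChainStruct

/-!
# (C1) JACKSON REMAINDER AT DEEP SCALES — the door along a `C⁴` curve with GRADED curve jets (Bell form)

Cell `gate-hubbard-kl`, seat hubbard-kl-k3c3-p3 (g11), `--supports stmt-HubbardSuperconductivity-20437` (stub (C) of `KLRegimeEngineV17F2`); pen (R79)
«(C1)-DEEP analytic supplier» GO.  Memo `HOME/hubbard-kl-k3c3-p3/C1-JETBOX-DEEP.md`.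

k3c3-p1's analytic (C1) door `jacksonRemainder_curve_jets` (…CountertermJacksonRemainderCurve, p533543) composes the momentum-space remainder table
(`norm_iteratedFDeriv_jhigh1_le_table`: `‖Dˡ(F − 𝒥_dF)(γθ)‖ ≤ Q_l`, `Q_l = Ml(l+1)·m₁ + (B l + Ml l)·τ` for `l ≤ 3`, `Q₄ = 2·Ml 4 + B 4·τ`,
`τ = π³/((d+1)δ)³`) with the curve through a SINGLE curve constant `‖γ^{(i)}(θ)‖ ≤ Dⁱ`.  At deep reading scales the flow frame's curve `γ_{n+1}` has
graded jets — `|γ′|, |γ″| = O(1)` but `|γ‴| ≲ R₃ + c·Gfr₃U²4ⁿ`, `|γ⁗| ≲ R₄ + c·Gfr₄U²16ⁿ` (`flowFrame_sizes_closed`, …JacksonRemainderScaleLaw) — so a single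
`D` would have to grow like `2ⁿ` and would spoil every order.  This file re-composes the SAME momentum-space table with the Bell-graded chain rule
`abs_iteratedDeriv_comp_le_bell` (…PerturbedFermiCurveCompChainStruct, k3c3-p3 g3):

* §1 **`jacksonRemainder_curve_jets_bell`**: `|R′| ≤ Q₁D₁`, `|R″| ≤ Q₂D₁² + Q₁D₂`, `|R‴| ≤ Q₃D₁³ + 3Q₂D₁D₂ + Q₁D₃`,
  `|R⁗| ≤ Q₄D₁⁴ + 6Q₃D₁²D₂ + 3Q₂D₂² + 4Q₂D₁D₃ + Q₁D₄` for graded `‖γ^{(i)}(θ)‖ ≤ D i`;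
* §2 **`jacksonRemainder_curve_jets_bell_rows`**: the same bounds regrouped by kernel homogeneity — the `m₁`-rows (`∝ 1/(d+1)`: RATE rows), the
  `τ`-rows (`∝ 1/((d+1)δ)³`: FAR rows) and the top-order no-rate row `2·Ml 4·D₁⁴` — i.e. exactly the three row shapes `p = 1, 3, 0` of
  `jacksonScale_term_law` / `jacksonScale_frame_term_law`, so that the growing `D₃, D₄` only ever multiply LOWER momentum orders (`Q₁D₄`, `Q₂D₁D₃`, …).

Pure real analysis (no definitions, nothing about the model); the flow instance with the `n`-bookkeeping is the next file of the lane.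
-/

noncomputable section

namespace Summit.HubbardSuperconductivity.HubbardSuperconductivity.Theorems.KLRegimeSplit

set_option linter.dupNamespace false -- summit = problem name (single-conjunct summit), D-0017

open Real MeasureTheory Filter
open Literature.Analysis.Fourier.TrigApprox Literature.MathematicalPhysics.QuantumLattice
open Summit.HubbardSuperconductivity.HubbardSuperconductivity.Theorems.PerturbedFermiCurve

section Door

variable {F : (Fin 2 → ℝ) → ℝ} {B : ℕ → ℝ} {γ : ℝ → EuclideanSpace ℝ (Fin 2)} {θ r : ℝ} {Ml : ℕ → ℝ} {δ : ℝ} {D : ℕ → ℝ}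

/-- **THE (C1) DOOR WITH GRADED CURVE JETS (Bell form).**  `R := (F − 𝒥_d F) ∘ ofLp ∘ γ`; local symbol sizes `Ml` on the `r`-ball about `γ θ`
(`2δ ≤ r`), global sizes `B`, GRADED curve sizes `‖γ^{(i)}(θ)‖ ≤ D i` (`1 ≤ i ≤ 4`), a first-moment bound `∫J̃J̃(|s|+|t|) ≤ m₁`, `τ := π³/((d+1)δ)³`,
`Q₁ = Ml 2·m₁ + (B 1 + Ml 1)τ`, `Q₂ = Ml 3·m₁ + (B 2 + Ml 2)τ`, `Q₃ = Ml 4·m₁ + (B 3 + Ml 3)τ`, `Q₄ = 2·Ml 4 + B 4·τ`: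
`|R′| ≤ Q₁·D₁`, `|R″| ≤ Q₂·D₁² + Q₁·D₂`, `|R‴| ≤ Q₃·D₁³ + 3Q₂·D₁D₂ + Q₁·D₃`, `|R⁗| ≤ Q₄·D₁⁴ + 6Q₃·D₁²D₂ + 3Q₂·D₂² + 4Q₂·D₁D₃ + Q₁·D₄`. -/
theorem jacksonRemainder_curve_jets_bell (d : ℕ) (hF : Continuous F)
    (hG : ContDiff ℝ 4 (fun q : EuclideanSpace ℝ (Fin 2) => F (WithLp.ofLp q)))
    (hB : ∀ i ≤ 4, ∀ y, ‖iteratedFDeriv ℝ i (fun q : EuclideanSpace ℝ (Fin 2) => F (WithLp.ofLp q)) y‖ ≤ B i)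
    (hγ : ContDiff ℝ 4 γ)
    (hMl : ∀ i ≤ 4, ∀ y : EuclideanSpace ℝ (Fin 2), ‖y - γ θ‖ ≤ r →
      ‖iteratedFDeriv ℝ i (fun q : EuclideanSpace ℝ (Fin 2) => F (WithLp.ofLp q)) y‖ ≤ Ml i)
    (hδ : 0 < δ) (hδπ : δ ≤ π) (hδr : 2 * δ ≤ r) {m₁ : ℝ} (hm₁ : ∫ w, jweight d w * (|w.1| + |w.2|) ∂jmeas ≤ m₁)
    (hD : ∀ i, 1 ≤ i → i ≤ 4 → ‖iteratedDeriv i γ θ‖ ≤ D i) :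
    |iteratedDeriv 1 ((fun q : EuclideanSpace ℝ (Fin 2) => jhigh1 d F (WithLp.ofLp q)) ∘ γ) θ| ≤
      (Ml 2 * m₁ + (B 1 + Ml 1) * (π ^ 3 / ((d + 1) * δ) ^ 3)) * D 1 ∧
    |iteratedDeriv 2 ((fun q : EuclideanSpace ℝ (Fin 2) => jhigh1 d F (WithLp.ofLp q)) ∘ γ) θ| ≤
      (Ml 3 * m₁ + (B 2 + Ml 2) * (π ^ 3 / ((d + 1) * δ) ^ 3)) * D 1 ^ 2 +
        (Ml 2 * m₁ + (B 1 + Ml 1) * (π ^ 3 / ((d + 1) * δ) ^ 3)) * D 2 ∧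
    |iteratedDeriv 3 ((fun q : EuclideanSpace ℝ (Fin 2) => jhigh1 d F (WithLp.ofLp q)) ∘ γ) θ| ≤
      (Ml 4 * m₁ + (B 3 + Ml 3) * (π ^ 3 / ((d + 1) * δ) ^ 3)) * D 1 ^ 3 +
        3 * (Ml 3 * m₁ + (B 2 + Ml 2) * (π ^ 3 / ((d + 1) * δ) ^ 3)) * D 1 * D 2 +
        (Ml 2 * m₁ + (B 1 + Ml 1) * (π ^ 3 / ((d + 1) * δ) ^ 3)) * D 3 ∧
    |iteratedDeriv 4 ((fun q : EuclideanSpace ℝ (Fin 2) => jhigh1 d F (WithLp.ofLp q)) ∘ γ) θ| ≤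
      (2 * Ml 4 + B 4 * (π ^ 3 / ((d + 1) * δ) ^ 3)) * D 1 ^ 4 +
        6 * (Ml 4 * m₁ + (B 3 + Ml 3) * (π ^ 3 / ((d + 1) * δ) ^ 3)) * D 1 ^ 2 * D 2 +
        3 * (Ml 3 * m₁ + (B 2 + Ml 2) * (π ^ 3 / ((d + 1) * δ) ^ 3)) * D 2 ^ 2 +
        4 * (Ml 3 * m₁ + (B 2 + Ml 2) * (π ^ 3 / ((d + 1) * δ) ^ 3)) * D 1 * D 3 +
        (Ml 2 * m₁ + (B 1 + Ml 1) * (π ^ 3 / ((d + 1) * δ) ^ 3)) * D 4 := by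
  have h := abs_iteratedDeriv_comp_le_bell (contDiff_jhigh1_onM d hF hG hB) hγ
    (M := fun l : ℕ => if l = 4 then 2 * Ml 4 + B 4 * (π ^ 3 / ((d + 1) * δ) ^ 3)
      else Ml (l + 1) * m₁ + (B l + Ml l) * (π ^ 3 / ((d + 1) * δ) ^ 3))
    (fun k hk1 hk4 => norm_iteratedFDeriv_jhigh1_le_table d hF hG hB hMl hδ hδπ hδr hm₁ hk1 hk4) hD
  simp only [show (1 : ℕ) ≠ 4 by norm_num, show (2 : ℕ) ≠ 4 by norm_num, show (3 : ℕ) ≠ 4 by norm_num, ↓reduceIte] at h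
  exact h

/-- **The same bounds regrouped by kernel homogeneity** (RATE rows `∝ m₁ ≍ 1/(d+1)`, FAR rows `∝ τ ≍ 1/((d+1)δ)³`, the no-rate top row `2·Ml 4·D₁⁴`):
`|R′| ≤ m₁·(Ml 2·D₁) + τ·((B 1+Ml 1)D₁)`,
`|R″| ≤ m₁·(Ml 3·D₁² + Ml 2·D₂) + τ·((B 2+Ml 2)D₁² + (B 1+Ml 1)D₂)`,
`|R‴| ≤ m₁·(Ml 4·D₁³ + 3Ml 3·D₁D₂ + Ml 2·D₃) + τ·((B 3+Ml 3)D₁³ + 3(B 2+Ml 2)D₁D₂ + (B 1+Ml 1)D₃)`,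
`|R⁗| ≤ 2Ml 4·D₁⁴ + m₁·(6Ml 4·D₁²D₂ + 3Ml 3·D₂² + 4Ml 3·D₁D₃ + Ml 2·D₄) + τ·(B 4·D₁⁴ + 6(B 3+Ml 3)D₁²D₂ + 3(B 2+Ml 2)D₂² + 4(B 2+Ml 2)D₁D₃ + (B 1+Ml 1)D₄)`.
These are the row shapes `p = 1, 3, 0` of `jacksonScale_term_law` / `jacksonScale_frame_term_law` (…JacksonRemainderScaleLaw): the growing curve jets
`D₃, D₄` of a deep flow frame only ever multiply the LOWER momentum orders `Ml 2, Ml 3` (and `B 1, B 2`). -/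
theorem jacksonRemainder_curve_jets_bell_rows (d : ℕ) (hF : Continuous F)
    (hG : ContDiff ℝ 4 (fun q : EuclideanSpace ℝ (Fin 2) => F (WithLp.ofLp q)))
    (hB : ∀ i ≤ 4, ∀ y, ‖iteratedFDeriv ℝ i (fun q : EuclideanSpace ℝ (Fin 2) => F (WithLp.ofLp q)) y‖ ≤ B i)
    (hγ : ContDiff ℝ 4 γ)
    (hMl : ∀ i ≤ 4, ∀ y : EuclideanSpace ℝ (Fin 2), ‖y - γ θ‖ ≤ r →
      ‖iteratedFDeriv ℝ i (fun q : EuclideanSpace ℝ (Fin 2) => F (WithLp.ofLp q)) y‖ ≤ Ml i)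
    (hδ : 0 < δ) (hδπ : δ ≤ π) (hδr : 2 * δ ≤ r) {m₁ : ℝ} (hm₁ : ∫ w, jweight d w * (|w.1| + |w.2|) ∂jmeas ≤ m₁)
    (hD : ∀ i, 1 ≤ i → i ≤ 4 → ‖iteratedDeriv i γ θ‖ ≤ D i) :
    |iteratedDeriv 1 ((fun q : EuclideanSpace ℝ (Fin 2) => jhigh1 d F (WithLp.ofLp q)) ∘ γ) θ| ≤
      m₁ * (Ml 2 * D 1) + (π ^ 3 / ((d + 1) * δ) ^ 3) * ((B 1 + Ml 1) * D 1) ∧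
    |iteratedDeriv 2 ((fun q : EuclideanSpace ℝ (Fin 2) => jhigh1 d F (WithLp.ofLp q)) ∘ γ) θ| ≤
      m₁ * (Ml 3 * D 1 ^ 2 + Ml 2 * D 2) + (π ^ 3 / ((d + 1) * δ) ^ 3) * ((B 2 + Ml 2) * D 1 ^ 2 + (B 1 + Ml 1) * D 2) ∧
    |iteratedDeriv 3 ((fun q : EuclideanSpace ℝ (Fin 2) => jhigh1 d F (WithLp.ofLp q)) ∘ γ) θ| ≤
      m₁ * (Ml 4 * D 1 ^ 3 + 3 * Ml 3 * D 1 * D 2 + Ml 2 * D 3) +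
        (π ^ 3 / ((d + 1) * δ) ^ 3) * ((B 3 + Ml 3) * D 1 ^ 3 + 3 * (B 2 + Ml 2) * D 1 * D 2 + (B 1 + Ml 1) * D 3) ∧
    |iteratedDeriv 4 ((fun q : EuclideanSpace ℝ (Fin 2) => jhigh1 d F (WithLp.ofLp q)) ∘ γ) θ| ≤
      2 * Ml 4 * D 1 ^ 4 +
        m₁ * (6 * Ml 4 * D 1 ^ 2 * D 2 + 3 * Ml 3 * D 2 ^ 2 + 4 * Ml 3 * D 1 * D 3 + Ml 2 * D 4) +
        (π ^ 3 / ((d + 1) * δ) ^ 3) *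
          (B 4 * D 1 ^ 4 + 6 * (B 3 + Ml 3) * D 1 ^ 2 * D 2 + 3 * (B 2 + Ml 2) * D 2 ^ 2 + 4 * (B 2 + Ml 2) * D 1 * D 3 +
            (B 1 + Ml 1) * D 4) := by
  obtain ⟨h1, h2, h3, h4⟩ := jacksonRemainder_curve_jets_bell d hF hG hB hγ hMl hδ hδπ hδr hm₁ hD
  refine ⟨h1.trans (le_of_eq ?_), h2.trans (le_of_eq ?_), h3.trans (le_of_eq ?_), h4.trans (le_of_eq ?_)⟩ <;> ring

/-- **The value row** (unchanged from part 2, recorded here for the one-stop consumer): `|R(θ)| ≤ m₁·Ml 1 + τ·(B 0 + Ml 0)`. -/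
theorem jacksonRemainder_curve_value_rows (d : ℕ) (hF : Continuous F)
    (hG : ContDiff ℝ 4 (fun q : EuclideanSpace ℝ (Fin 2) => F (WithLp.ofLp q)))
    (hB : ∀ i ≤ 4, ∀ y, ‖iteratedFDeriv ℝ i (fun q : EuclideanSpace ℝ (Fin 2) => F (WithLp.ofLp q)) y‖ ≤ B i)
    (hMl : ∀ i ≤ 4, ∀ y : EuclideanSpace ℝ (Fin 2), ‖y - γ θ‖ ≤ r →
      ‖iteratedFDeriv ℝ i (fun q : EuclideanSpace ℝ (Fin 2) => F (WithLp.ofLp q)) y‖ ≤ Ml i)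
    (hδ : 0 < δ) (hδπ : δ ≤ π) (hδr : 2 * δ ≤ r) {m₁ : ℝ} (hm₁ : ∫ w, jweight d w * (|w.1| + |w.2|) ∂jmeas ≤ m₁) :
    |jhigh1 d F (WithLp.ofLp (γ θ))| ≤ m₁ * Ml 1 + (π ^ 3 / ((d + 1) * δ) ^ 3) * (B 0 + Ml 0) := by
  have h := abs_jhigh1_curve_le d hF hG hB hMl hδ hδπ hδr hm₁ (γ := γ) (θ := θ)
  linarith [h]

end Door

/-! ## §3 The deep-scale shape of the rows (what decays, what is `n`-free)

With the flow instance's data at reading scale `n+1` (next file of the lane): `m₁ ≤ π√3/(d_n+1)` (…JacksonSharpMoments), `τ = π³/((d_n+1)δ)³` with the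
FIXED flat-tube margin `δ`, `Ml i ≤ Σ_l a_l(n)·c_{i,l}/ρ^i` (k3c3-p1's `localSizes_onM_klFrameExtFn_of_ball`, `ρ` = local radius lower bound), `B i` the
fixed cutoff-zone sizes, `D 1, D 2` window constants, `D 3 ≤ R₃ + c₃·A₃(n+1)`, `D 4 ≤ R₄ + c₄·A₄(n+1) + …` (`A_j(n+1)` from `flowFrame_sizes_closed`):
every `m₁`-row is a `p = 1` row of `jacksonScale_term_law` (the RATE rows; the only `n`-free one is `Ml(k+1)·D₁ᵏ`, coupling `(c_{k+1}/c_k)·(D₁/ρ)ᵏ·(m₁(d+1))/(2⁷ρ·4^{k−2})`),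
every `τ`-row a `p = 3` row (decaying `64^{−n}` on top of its table ratio), the top row `2·Ml 4·D₁⁴` a `p = 0` row (`≈ 2(D₁/ρ)⁴` of the previous
four-jet against a bar `16×` larger), and the rows carrying `D₃, D₄` are `jacksonScale_frame_term_law` rows with exponent `≤ −2n`. -/

end Summit.HubbardSuperconductivity.HubbardSuperconductivity.Theorems.KLRegimeSplit

end
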